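import Summits.HubbardSuperconductivity.HubbardSuperconductivity.Theorems.BalabanIRBirGappedPhaseReductionTemporalModes
import Literature.Analysis.Matrix.ExponentialScalarSquare
import HarnessLib

/-!
# Route BalabanIR — crux 4 `BirGappedPhaseReduction` / 4R (items `stmt-HubbardSuperconductivity-2082`, `…-14846`):
# the symbol-block Gibbs weights in closed form, and which modes are temporally coercive

Completes the zero-mode temporal-coercivity story (`…TemporalModes.norm_det_one_add_prod_torusBdG_le`)
with the explicit one-mode data. For the `2 × 2` BdG symbol block `h = !![ξ, D; conj D, -ξ]` (real `ξ`,
`E = √(ξ² + ‖D‖²)`):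

* `symbolBlock_mul_self`, `symbolBlock_sq_eq` — `h² = E² • 1`;
* **`gibbsWeight_symbolBlock`** — `e^{-ah} = cosh(aE) • 1 - (sinh(aE)/E) • h`
  (`Literature.Analysis.Matrix.exp_smul_of_mul_self_eq_smul_one`);
* `gibbsWeight_symbolBlock_apply_one_zero(_ne_zero)` — the pair-hopping entry is `-(sinh(aE)/E) conj D`,
  NONZERO iff `D ≠ 0` (`a ≠ 0`); `det_gibbsWeight_symbolBlock` — `det e^{-ah} = cosh² - sinh² = 1`;
* **`exists_admissible_family_symbolBlock`** — for `a ≠ 0` there is an admissible family `κ` for the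
  gauge-fixed weights `Ĝ_k` with `κ_k > 0` at EVERY mode with `Δ̂ k ≠ 0`: in the bound of
  `norm_det_one_add_prod_torusBdG_le` all modes off the nodes of the gap symbol are strictly coercive,
  `det Ĝ_k = 1`, and the phase-blind part per mode is `2` against `tr G_k^{2k} = 2cosh(2k·aE_k)`.

`Theses`-free, no definitions; `--supports` the crux. [folklore]
-/

noncomputable section

namespace Summit.HubbardSuperconductivity.HubbardSuperconductivity.Theorems

namespace BirBdG

open Matrix NormedSpace Literature.Probability.LatticeModels
open scoped ComplexConjugate ComplexOrder

/-! ### Explicit symbol-block Gibbs weights -/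

section SymbolBlock

open scoped Matrix.Norms.L2Operator

/-- The BdG symbol block squares to a scalar: `!![ξ, D; conj D, -ξ]² = (ξ² + D conj D) • 1`. [folklore] -/
theorem symbolBlock_mul_self (ξ D : ℂ) :
    (!![ξ, D; star D, -ξ] : Matrix (Fin 2) (Fin 2) ℂ) * !![ξ, D; star D, -ξ] =
      (ξ ^ 2 + D * star D) • (1 : Matrix (Fin 2) (Fin 2) ℂ) := by
  ext i j
  fin_cases i <;> fin_cases j <;>
    simp [Matrix.mul_apply, Fin.sum_univ_two] <;> ring

/-- `ξ² + D conj D = E²` with `E = √(ξ² + ‖D‖²)` for real `ξ`. [folklore] -/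
theorem symbolBlock_sq_eq (ξ : ℝ) (D : ℂ) :
    ((ξ : ℂ) ^ 2 + D * star D) = ((Real.sqrt (ξ ^ 2 + ‖D‖ ^ 2) : ℂ)) ^ 2 := by
  have h : ((Real.sqrt (ξ ^ 2 + ‖D‖ ^ 2) : ℂ)) ^ 2 = ((ξ ^ 2 + ‖D‖ ^ 2 : ℝ) : ℂ) := by
    rw [← Complex.ofReal_pow, Real.sq_sqrt (by positivity)]
  rw [h, Complex.star_def, Complex.mul_conj, Complex.normSq_eq_norm_sq]
  push_cast
  ring

/-- **The Gibbs weight of a BdG symbol block in closed form**: for real `ξ`, any `D`, `a`, and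
`E = √(ξ² + ‖D‖²) ≠ 0`,
`e^{-a h} = cosh(aE) • 1 - (sinh(aE)/E) • h`, `h = !![ξ, D; conj D, -ξ]`. [folklore] -/
theorem gibbsWeight_symbolBlock (ξ : ℝ) (D : ℂ) (a : ℝ) (hE : ξ ^ 2 + ‖D‖ ^ 2 ≠ 0) :
    Matrix.gibbsWeight a (!![(ξ : ℂ), D; star D, -(ξ : ℂ)] : Matrix (Fin 2) (Fin 2) ℂ) =
      (Real.cosh (a * Real.sqrt (ξ ^ 2 + ‖D‖ ^ 2)) : ℂ) • (1 : Matrix (Fin 2) (Fin 2) ℂ) -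
        ((Real.sinh (a * Real.sqrt (ξ ^ 2 + ‖D‖ ^ 2)) / Real.sqrt (ξ ^ 2 + ‖D‖ ^ 2) : ℝ) : ℂ) •
          (!![(ξ : ℂ), D; star D, -(ξ : ℂ)] : Matrix (Fin 2) (Fin 2) ℂ) := by
  set E : ℝ := Real.sqrt (ξ ^ 2 + ‖D‖ ^ 2) with hEdef
  have hEpos : 0 < E := Real.sqrt_pos.mpr (lt_of_le_of_ne (by positivity) (Ne.symm hE))
  have hE' : (E : ℂ) ≠ 0 := Complex.ofReal_ne_zero.mpr hEpos.ne'
  have hsq : (!![(ξ : ℂ), D; star D, -(ξ : ℂ)] : Matrix (Fin 2) (Fin 2) ℂ) *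
      !![(ξ : ℂ), D; star D, -(ξ : ℂ)] = ((E : ℂ) ^ 2) • (1 : Matrix (Fin 2) (Fin 2) ℂ) := by
    rw [symbolBlock_mul_self, symbolBlock_sq_eq]
  have h := Literature.Analysis.Matrix.exp_smul_of_mul_self_eq_smul_one hsq hE' (-(a : ℂ))
  rw [Matrix.gibbsWeight]
  refine h.trans ?_
  rw [neg_mul, Complex.cosh_neg, Complex.sinh_neg, ← Complex.ofReal_mul, ← Complex.ofReal_cosh,
    ← Complex.ofReal_sinh, neg_div, neg_smul, ← sub_eq_add_neg, ← Complex.ofReal_div]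

/-- Entries of the symbol-block Gibbs weight: the pair-hopping (off-diagonal) entry is
`-(sinh(aE)/E) conj D`. [folklore] -/
theorem gibbsWeight_symbolBlock_apply_one_zero (ξ : ℝ) (D : ℂ) (a : ℝ) (hE : ξ ^ 2 + ‖D‖ ^ 2 ≠ 0) :
    Matrix.gibbsWeight a (!![(ξ : ℂ), D; star D, -(ξ : ℂ)] : Matrix (Fin 2) (Fin 2) ℂ) 1 0 =
      -(((Real.sinh (a * Real.sqrt (ξ ^ 2 + ‖D‖ ^ 2)) / Real.sqrt (ξ ^ 2 + ‖D‖ ^ 2) : ℝ) : ℂ) * star D) := by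
  rw [gibbsWeight_symbolBlock ξ D a hE]
  simp

/-- **The pair-hopping entry is nonzero iff `D ≠ 0` (for `a ≠ 0`)**: the coercive modes of the
zero-mode temporal bound are exactly those with nonvanishing gap symbol. [folklore] -/
theorem gibbsWeight_symbolBlock_apply_one_zero_ne_zero (ξ : ℝ) {D : ℂ} (hD : D ≠ 0) {a : ℝ} (ha : a ≠ 0) :
    Matrix.gibbsWeight a (!![(ξ : ℂ), D; star D, -(ξ : ℂ)] : Matrix (Fin 2) (Fin 2) ℂ) 1 0 ≠ 0 := by
  have hE : ξ ^ 2 + ‖D‖ ^ 2 ≠ 0 := by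
    have : 0 < ‖D‖ := norm_pos_iff.mpr hD
    positivity
  have hEpos : 0 < Real.sqrt (ξ ^ 2 + ‖D‖ ^ 2) :=
    Real.sqrt_pos.mpr (lt_of_le_of_ne (by positivity) (Ne.symm hE))
  rw [gibbsWeight_symbolBlock_apply_one_zero ξ D a hE, neg_ne_zero, mul_ne_zero_iff]
  refine ⟨?_, star_ne_zero.mpr hD⟩
  rw [Complex.ofReal_ne_zero, div_ne_zero_iff]
  exact ⟨Real.sinh_ne_zero.mpr (mul_ne_zero ha hEpos.ne'), hEpos.ne'⟩

/-- The symbol-block Gibbs weight has determinant one: `cosh² - sinh² = 1`. [folklore] -/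
theorem det_gibbsWeight_symbolBlock (ξ : ℝ) (D : ℂ) (a : ℝ) (hE : ξ ^ 2 + ‖D‖ ^ 2 ≠ 0) :
    (Matrix.gibbsWeight a (!![(ξ : ℂ), D; star D, -(ξ : ℂ)] : Matrix (Fin 2) (Fin 2) ℂ)).det = 1 := by
  have hEpos : 0 < Real.sqrt (ξ ^ 2 + ‖D‖ ^ 2) :=
    Real.sqrt_pos.mpr (lt_of_le_of_ne (by positivity) (Ne.symm hE))
  have hE' : ((Real.sqrt (ξ ^ 2 + ‖D‖ ^ 2) : ℝ) : ℂ) ≠ 0 := Complex.ofReal_ne_zero.mpr hEpos.ne'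
  have hEsq : ((Real.sqrt (ξ ^ 2 + ‖D‖ ^ 2) : ℂ)) ^ 2 = (ξ : ℂ) ^ 2 + D * star D :=
    (symbolBlock_sq_eq ξ D).symm
  have hc := Complex.cosh_sq_sub_sinh_sq ((a : ℂ) * (Real.sqrt (ξ ^ 2 + ‖D‖ ^ 2) : ℂ))
  have key : (Complex.cosh ((a : ℂ) * (Real.sqrt (ξ ^ 2 + ‖D‖ ^ 2) : ℂ))) ^ 2 -
      (Complex.sinh ((a : ℂ) * (Real.sqrt (ξ ^ 2 + ‖D‖ ^ 2) : ℂ)) / (Real.sqrt (ξ ^ 2 + ‖D‖ ^ 2) : ℂ)) ^ 2 *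
        ((ξ : ℂ) ^ 2 + D * star D) = 1 := by
    rw [← hEsq]
    field_simp
    linear_combination hc
  rw [gibbsWeight_symbolBlock ξ D a hE, det_fin_two]
  simp only [Matrix.sub_apply, Matrix.smul_apply, Matrix.one_apply_eq, Matrix.of_apply, Matrix.cons_val',
    Matrix.cons_val_zero, Matrix.cons_val_one, Matrix.cons_val_fin_one, Matrix.empty_val', smul_eq_mul, mul_one,
    ne_eq, zero_ne_one, not_false_eq_true, Matrix.one_apply_ne, one_ne_zero, mul_zero, zero_sub, mul_neg]
  push_cast
  linear_combination key

/-- **Coercive modes of the torus reference**: for `a ≠ 0` there is an admissible family `κ` for the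
gauge-fixed symbol-block Gibbs weights `Ĝ_k` (`Gr`, given by `hGr`) with `κ_k > 0` at every mode with
`Δ̂ k ≠ 0` (and `κ_k ≥ 0` everywhere) — the input of `norm_det_one_add_prod_torusBdG_le`. [folklore] -/
theorem exists_admissible_family_symbolBlock {m : Type*} (ξ : m → ℝ) (Δ : m → ℂ) {a : ℝ} (ha : a ≠ 0)
    (Gr : m → Matrix (Fin 2) (Fin 2) ℝ)
    (hGr : ∀ k, Gr k =
      !![(Matrix.gibbsWeight a (!![(ξ k : ℂ), Δ k; star (Δ k), -(ξ k : ℂ)] : Matrix (Fin 2) (Fin 2) ℂ) 0 0).re,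
          ‖Matrix.gibbsWeight a (!![(ξ k : ℂ), Δ k; star (Δ k), -(ξ k : ℂ)] : Matrix (Fin 2) (Fin 2) ℂ) 1 0‖;
        ‖Matrix.gibbsWeight a (!![(ξ k : ℂ), Δ k; star (Δ k), -(ξ k : ℂ)] : Matrix (Fin 2) (Fin 2) ℂ) 1 0‖,
          (Matrix.gibbsWeight a (!![(ξ k : ℂ), Δ k; star (Δ k), -(ξ k : ℂ)] : Matrix (Fin 2) (Fin 2) ℂ) 1 1).re]) :
    ∃ κ : m → ℝ, (∀ k, 0 ≤ κ k) ∧ (∀ k, Δ k ≠ 0 → 0 < κ k) ∧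
      ∀ k (b b' : Fin 2), κ k * (Gr k b 0 * Gr k 0 b' + Gr k b 1 * Gr k 1 b') ^ 2 ≤
        (Gr k b 0 * Gr k 0 b') * (Gr k b 1 * Gr k 1 b') := by
  have hh : ∀ k, (!![(ξ k : ℂ), Δ k; star (Δ k), -(ξ k : ℂ)] : Matrix (Fin 2) (Fin 2) ℂ).IsHermitian :=
    fun k => isHermitian_symbolBlock (Complex.conj_ofReal _)
  have hGr0 : ∀ k i j, 0 ≤ Gr k i j := by
    intro k i j
    have hPSD := (posDef_gibbsWeight a (hh k)).posSemidef
    rw [hGr k]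
    fin_cases i <;> fin_cases j
    · exact (Complex.nonneg_iff.mp hPSD.diag_nonneg).1
    · exact norm_nonneg (Matrix.gibbsWeight a
        (!![(ξ k : ℂ), Δ k; star (Δ k), -(ξ k : ℂ)] : Matrix (Fin 2) (Fin 2) ℂ) 1 0)
    · exact norm_nonneg (Matrix.gibbsWeight a
        (!![(ξ k : ℂ), Δ k; star (Δ k), -(ξ k : ℂ)] : Matrix (Fin 2) (Fin 2) ℂ) 1 0)
    · exact (Complex.nonneg_iff.mp hPSD.diag_nonneg).1
  obtain ⟨κ, hκ0, hκpos, hκ⟩ := exists_admissible_family Gr hGr0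
  refine ⟨κ, hκ0, fun k hk => hκpos k ?_, hκ⟩
  rw [hGr k]
  exact (gaugeFix_pos_iff (hh k) a).mpr (gibbsWeight_symbolBlock_apply_one_zero_ne_zero (ξ k) hk ha)

end SymbolBlock

end BirBdG

end Summit.HubbardSuperconductivity.HubbardSuperconductivity.Theorems
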